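import Summits.BirchSwinnertonDyer.BirchSwinnertonDyer.Theorems.UniversalToricDescentRationalSplitIMCInclusionAtThreeClosedModuloV85
import Summits.BirchSwinnertonDyer.BirchSwinnertonDyer.Theorems.UniversalToricDescentNormalisedToricFrameDefs
import HarnessLib

/-!
# The rational wall `RationalSplitIMCInclusionAtThree` (stmt-BirchSwinnertonDyer-24207) CLOSED MODULO FOUR NAMED STATEMENTS
# (certificate `V86` = the glue of line `ratwall_thin_comb` v10 with EVERY input BY NAME; `--supports stmt-BirchSwinnertonDyer-24207`;
# cell `pub/bsd-wall`, LEAD `cruxlead-24207` g36)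

WHY THIS FILE. After this gen every `sorry` of the line's skeleton v10 is a NAME: (N♭) is the route-independent `@[conjecture]` constant
`…Theorems.UniversalToricDescentNormalisedToricFrameDefs.NormalisedToricFrameUpToUnitAtThree` (p771772), K2-rat is the route item
stmt-BirchSwinnertonDyer-32493 `…Theses.UniversalToricDescent.RatThinCombDvdUpToTwoAtThree` (UTD rev 92), and the two print inputs are the typed
Literature facts `jacquet1972_functionalEquation_rankinSelbergHecke_cone` (p767382) and `nekovar2006_xGr₂_isTorsion_iff_and_charIdeal_eq_map_inv`
(p754477). This file states the composition ONCE with the four names as hypotheses — the shape a planner's `--split` / by-name glue closes in one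
line, and the shape in which refuters, typers and the ladder read what the rational wall still owes:

* `RationalSplitIMCInclusionAtThree_of_named` :
  `NormalisedToricFrameUpToUnitAtThree → jacquet1972_… → nekovar2006_… → RatThinCombDvdUpToTwoAtThree → RationalSplitIMCInclusionAtThree`
  (= `V85.RationalSplitIMCInclusionAtThree_of_normalisedUpToUnit_of_jacquet_of_nekovar_of_ratCombDvd`, the constants unfolding definitionally).

HONEST SCOPE: an implication between named open statements; it proves none of them; crux 24207 stays OPEN (conditional-result); BSD is proved for
no curve; 24207 / 20395 / 20186 / 32493 OPEN.

References: [cite: Hida1988AIF, §5 Thm. 5.1b] [cite: Jacquet1972, §19 Thm. 19.14, Cor. 19.15] [cite: Nekovar2006, Thm. 8.9.9, Prop. 9.6.6 (ii)]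
[cite: Gu2025FiniteSlopeUniversalRS, Conj. 2.15 (arXiv:2512.01184)] [cite: SerreAbelianLadic1968, Ch. III §2.3]
-/

set_option linter.dupNamespace false
set_option autoImplicit false

noncomputable section

namespace Summit.BirchSwinnertonDyer.BirchSwinnertonDyer.Theorems.UniversalToricDescentRatwallThinCombLine.V86

/-- **THE RATIONAL WALL FROM FOUR NAMED STATEMENTS**: the normalised-up-to-`ℤ₃ˣ` toric existence (N♭) (`@[conjecture]` constant, adaptation of
Hida 1988 Thm. 5.1b at the additive split `3`), Jacquet's cone functional equation (print), Nekovář's two-variable algebraic functional equation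
(print), and the rational thin-comb divisibility K2-rat (route item 32493, research) imply `RationalSplitIMCInclusionAtThree` — the V85 certificate
with its two ∀-hypotheses replaced by their names. [cite: Hida1988AIF, §5 Thm. 5.1b] [cite: Jacquet1972, §19 Thm. 19.14, Cor. 19.15]
[cite: Nekovar2006, Thm. 8.9.9, Prop. 9.6.6 (ii)] [cite: Gu2025FiniteSlopeUniversalRS, Conj. 2.15 (arXiv:2512.01184)] -/
theorem RationalSplitIMCInclusionAtThree_of_named
    (hN : Summit.BirchSwinnertonDyer.BirchSwinnertonDyer.Theorems.UniversalToricDescentNormalisedToricFrameDefs.NormalisedToricFrameUpToUnitAtThree)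
    (hJ : Literature.NumberTheory.EllipticCurves.jacquet1972_functionalEquation_rankinSelbergHecke_cone)
    (hNek : Literature.NumberTheory.EllipticCurves.nekovar2006_xGr₂_isTorsion_iff_and_charIdeal_eq_map_inv)
    (hK2 : Summit.BirchSwinnertonDyer.BirchSwinnertonDyer.Theses.UniversalToricDescent.RatThinCombDvdUpToTwoAtThree) :
    Summit.BirchSwinnertonDyer.BirchSwinnertonDyer.Theses.UniversalToricDescent.RationalSplitIMCInclusionAtThree :=
  V85.RationalSplitIMCInclusionAtThree_of_normalisedUpToUnit_of_jacquet_of_nekovar_of_ratCombDvd hN hJ hNek hK2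

end Summit.BirchSwinnertonDyer.BirchSwinnertonDyer.Theorems.UniversalToricDescentRatwallThinCombLine.V86

end
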